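import Summits.ValiantsHypothesis.ValiantsHypothesis.Theorems.DivisionGapDefs

/-!
# Crux `DivisionGap.PerDivisionHard` (stmt-ValiantsHypothesis-5065), line `pair-descent-jss-endpoint`
(v15) — stub `stub_greedyRooks`: greedy rooks inside a dense cell set

`stub_greedyRooks`: a cell set `Z ⊆ [n] × [n]` with `|Z| ≥ 2nN` and `N ≤ n` contains `N` cells in
rook position (pairwise distinct rows and pairwise distinct columns).

Proof.  Greedy, by induction on the number `t ≤ N` of rooks placed.  The cells of `Z` sharing a
row or a column with one of the `t` rooks of `P` lie in `(rows P) ×ˢ univ ∪ univ ×ˢ (cols P)`, at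
most `t·n + n·t = 2tn` cells (`greedyRooks_step`), and `2tn < 2(t+1)n ≤ 2nN ≤ |Z|` because
`t + 1 ≤ N ≤ n` forces `n ≥ 1`; so some cell of `Z` has a fresh row and a fresh column, and
adding it keeps rook position (`Set.injOn_insert`).
-/

noncomputable section

-- `Summit.ValiantsHypothesis.ValiantsHypothesis.…` is the tree's mandated single-conjunct layout
-- (Sub = Summit), so the duplicated namespace component is intended.
set_option linter.dupNamespace false

namespace Summit.ValiantsHypothesis.ValiantsHypothesis.Theorems.DivisionGapPerDivisionHard

/-- One greedy step (counting): if `2n·|P| < |Z|` then some cell of `Z` lies in no row and no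
column of `P` — the blocked cells lie in `(P.image fst) ×ˢ univ ∪ univ ×ˢ (P.image snd)`, which
has at most `|P|·n + n·|P|` cells. [folklore] -/
theorem greedyRooks_step {n : ℕ} (Z P : Finset (Fin n × Fin n))
    (hcard : 2 * n * P.card < Z.card) :
    ∃ e ∈ Z, e.1 ∉ P.image Prod.fst ∧ e.2 ∉ P.image Prod.snd := by
  classical
  by_contra! h
  have hsub : Z ⊆ (P.image Prod.fst ×ˢ (Finset.univ : Finset (Fin n))) ∪
      ((Finset.univ : Finset (Fin n)) ×ˢ P.image Prod.snd) := by
    intro e he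
    rw [Finset.mem_union, Finset.mem_product, Finset.mem_product]
    by_cases h1 : e.1 ∈ P.image Prod.fst
    · exact Or.inl ⟨h1, Finset.mem_univ _⟩
    · exact Or.inr ⟨Finset.mem_univ _, h e he h1⟩
  have hle : Z.card ≤ 2 * n * P.card :=
    calc Z.card ≤ ((P.image Prod.fst ×ˢ (Finset.univ : Finset (Fin n))) ∪
          ((Finset.univ : Finset (Fin n)) ×ˢ P.image Prod.snd)).card := Finset.card_le_card hsub
      _ ≤ (P.image Prod.fst ×ˢ (Finset.univ : Finset (Fin n))).card +
          ((Finset.univ : Finset (Fin n)) ×ˢ P.image Prod.snd).card := Finset.card_union_le _ _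
      _ = (P.image Prod.fst).card * n + n * (P.image Prod.snd).card := by
          rw [Finset.card_product, Finset.card_product, Finset.card_univ, Fintype.card_fin]
      _ ≤ P.card * n + n * P.card :=
          Nat.add_le_add (Nat.mul_le_mul_right n Finset.card_image_le)
            (Nat.mul_le_mul_left n Finset.card_image_le)
      _ = 2 * n * P.card := by ring
  omega

/-- **`stub_greedyRooks` (registered sub-goal; greedy rooks).**  A cell set with at least `2nN`
cells (`N ≤ n`) contains `N` cells in rook position (pairwise distinct rows and columns):
greedily — `t < N` chosen rooks block at most `2tn < |Z|` cells of `Z`. [folklore] -/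
theorem stub_greedyRooks :
    ∀ (n N : ℕ) (Z : Finset (Fin n × Fin n)), N ≤ n → 2 * n * N ≤ Z.card →
      ∃ P : Finset (Fin n × Fin n), P ⊆ Z ∧ P.card = N ∧
        Set.InjOn Prod.fst (P : Set (Fin n × Fin n)) ∧ Set.InjOn Prod.snd (P : Set (Fin n × Fin n)) := by
  intro n N Z hN hZ
  classical
  suffices h : ∀ t ≤ N, ∃ P : Finset (Fin n × Fin n), P ⊆ Z ∧ P.card = t ∧
      Set.InjOn Prod.fst (P : Set (Fin n × Fin n)) ∧
        Set.InjOn Prod.snd (P : Set (Fin n × Fin n)) from h N le_rfl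
  intro t
  induction t with
  | zero =>
    intro _
    exact ⟨∅, Finset.empty_subset _, Finset.card_empty, by simp, by simp⟩
  | succ t ih =>
    intro ht
    obtain ⟨P, hPZ, hPcard, hfst, hsnd⟩ := ih (Nat.le_of_succ_le ht)
    have hlt : 2 * n * P.card < Z.card := by
      rw [hPcard]
      have hn : 0 < 2 * n := by omega
      exact lt_of_lt_of_le (Nat.mul_lt_mul_of_pos_left (Nat.lt_of_succ_le ht) hn) hZ
    obtain ⟨e, heZ, he1, he2⟩ := greedyRooks_step Z P hlt
    have heP : e ∉ P := fun h => he1 (Finset.mem_image_of_mem Prod.fst h)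
    have heP' : e ∉ (P : Set (Fin n × Fin n)) := fun h => heP (Finset.mem_coe.mp h)
    refine ⟨insert e P, Finset.insert_subset heZ hPZ,
      by rw [Finset.card_insert_of_notMem heP, hPcard], ?_, ?_⟩
    · rw [Finset.coe_insert, Set.injOn_insert heP', ← Finset.coe_image]
      exact ⟨hfst, fun h => he1 (Finset.mem_coe.mp h)⟩
    · rw [Finset.coe_insert, Set.injOn_insert heP', ← Finset.coe_image]
      exact ⟨hsnd, fun h => he2 (Finset.mem_coe.mp h)⟩

end Summit.ValiantsHypothesis.ValiantsHypothesis.Theorems.DivisionGapPerDivisionHard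

end
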